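import Summits.Ventures.Crystal3D.Theorems.StickyWulffConstantCoaxialWallLawSeamJunkCapTable
import HarnessLib

/-!
# The incoherent-side assembly in Σ-FORM ON THE SEAM SIDE: `SeamSumSmall σ₀` replaces the per-ball `SeamSparsity p₀ n₀` (crux `CoaxialWallLaw`, stmt-Ventures-19481;
# line `WallLedgerF`, skeleton 'CoaxialWallLawCertificates' v8.1, stub `stub_incoherentSeamSmall`)

HONEST FRAMING. Venture `Summits/Ventures/Crystal3D` (cell `crystal3d-full`); a WEAKER analytic input for the closer of record of `stub_incoherentSeamSmall`
(`…SeamIncoherentAssembly.incoherentSeamSmall_of_assembly`), and the assembly re-proved from it.  Nothing is claimed about the stub; no input is proved; F-C1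
not moved.
WHY: `SeamSparsity p₀ n₀ k₀` asks PER BALL that every seam-loaded ball `b` within `1` of the payer has `p₀ · seamCoreMultA b ≤ pooledDef b` (calibration `p₀ = 8`);
but the exported two-payer clause only guarantees `pooledDef b ≥ 1–2`, so one seam pair at a well-coordinated end ball costs `≤ 1/2` in `Σ_A` and is harmless for
the line `2√6` while refuting the per-ball ratio.  What the comparison really consumes is the SEAM SUM:
* `localSummandA_le_core_add_seamSum` — `Σ_A(Y, z) ≤ Σ_{b ∈ E} e_E(b)/(lowered pool) + Σ_{b seam-loaded within 1} seamCoreMultA(b)/pooledDef Y b` (the seam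
  part is an IDENTITY: no ratio hypothesis, no `p₀`);
* `SeamSumSmall σ₀ k₀` (named input, analytic, Σ-form): residual hypotheses ∧ `¬ CoherentAt` ⇒ deletion on-site ∨ for SOME placement `S` the seam sum is `≤ σ₀`;
* `seamSumSmall_of_seamSparsity` — the per-ball input implies it with `σ₀ = n₀/p₀` (nothing typed against v8.1 is lost);
* **`incoherentSeamSmall_of_assembly_sum`** — `CoherentCoreCap cap s₁ → JunkCapBound cap → SeamSumSmall σ₀ k₀ → s₁ + σ₀ ≤ s → IncoherentSeamSmall s k₀`, and
  **`incoherentSeamSmall_of_cert_of_seamSum`** — the same with the junk input discharged (`capTable₀`, any dominating cap).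
So the analytic debt of lane F's T5b is `SeamSumSmall (2√6 − s₁) 3` (budget `≈ 1.8` at `s₁ ≈ 3.1`), not a per-ball ratio `8`.
-/

noncomputable section

namespace Summit.Ventures.Crystal3D.Theorems

namespace TailResidue

open Summit.Ventures.Crystal3D Finset
open scoped InnerProductSpace

section SplitSum

variable {Y E : Finset (EuclideanSpace ℝ (Fin 3))} {v : WordVersion} {S₁ S₂ : PlateSystem}
variable (hY : ∀ p ∈ Y, ∀ q ∈ Y, p ≠ q → 1 ≤ dist p q) (hsub : E ⊆ Y) (h₁ : S₁.RT ⊆ fccSlots) (h₂ : S₂.RT ⊆ fccSlots)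

include hY hsub h₁ h₂ in
open scoped Classical in
/-- **THE CORE / SEAM SPLIT with the seam part as a SUM** (`…SeamIncoherentAssembly.localSummandA_le_core_add_seam_at` without the per-ball ratio): for a core
`E ⊆ Y`, if every lowered pool `p_E(b) − heal(b) + def(b)` at a loaded core ball within `1` of the payer is positive, then
`Σ_A(Y, z) ≤ Σ_{b ∈ E, |b−z| ≤ 1} e_E(b)/(p_E(b) − heal(b) + def(b)) + Σ_{b ∈ Y, |b−z| ≤ 1, seam-loaded} seamCoreMultA(b)/pooledDef Y b`. -/
theorem localSummandA_le_core_add_seamSum (z : EuclideanSpace ℝ (Fin 3))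
    (hposE : ∀ b ∈ E, dist z b ≤ 1 → 0 < endMultA E v S₁ S₂ b →
      0 < pooledDef E b - ((((E.filter fun y => dist b y ≤ 1) ×ˢ (Y \ E)).filter fun p => dist p.1 p.2 = 1).card : ℝ) +
        ∑ x ∈ (Y \ E).filter (fun x => dist b x ≤ 1 ∧ (Y.filter fun q => dist x q = 1).card ≤ 11),
          ((12 : ℝ) - ((Y.filter fun q => dist x q = 1).card : ℝ))) :
    localSummandA v S₁ S₂ Y z ≤
      (∑ b ∈ E.filter (fun b => dist z b ≤ 1 ∧ 0 < endMultA E v S₁ S₂ b),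
        (endMultA E v S₁ S₂ b : ℝ) /
          (pooledDef E b - ((((E.filter fun y => dist b y ≤ 1) ×ˢ (Y \ E)).filter fun p => dist p.1 p.2 = 1).card : ℝ) +
            ∑ x ∈ (Y \ E).filter (fun x => dist b x ≤ 1 ∧ (Y.filter fun q => dist x q = 1).card ≤ 11),
              ((12 : ℝ) - ((Y.filter fun q => dist x q = 1).card : ℝ)))) +
      ∑ b ∈ Y.filter (fun b => dist z b ≤ 1 ∧ 0 < seamCoreMultA Y E v S₁ S₂ b), (seamCoreMultA Y E v S₁ S₂ b : ℝ) / pooledDef Y b := by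
  unfold localSummandA
  have hexle : ∀ b, coreMultA Y E v S₁ S₂ b ≤ endMultA E v S₁ S₂ b := fun b => coreMultA_le hY hsub h₁ h₂ b
  have hpoolle : ∀ b, pooledDef E b +
      ∑ x ∈ (Y \ E).filter (fun x => dist b x ≤ 1 ∧ (Y.filter fun q => dist x q = 1).card ≤ 11), ((12 : ℝ) - ((Y.filter fun q => dist x q = 1).card : ℝ)) ≤
      pooledDef Y b + (((E.filter fun y => dist b y ≤ 1) ×ˢ (Y \ E)).filter fun p => dist p.1 p.2 = 1).card := fun b => pooledDef_core_le hY hsub b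
  set A := Y.filter (fun b => dist z b ≤ 1 ∧ 0 < endMultA Y v S₁ S₂ b) with hA
  set AE := E.filter (fun b => dist z b ≤ 1 ∧ 0 < endMultA E v S₁ S₂ b) with hAE
  set AS := Y.filter (fun b => dist z b ≤ 1 ∧ 0 < seamCoreMultA Y E v S₁ S₂ b) with hAS
  set D : EuclideanSpace ℝ (Fin 3) → ℝ := fun b =>
    pooledDef E b - ((((E.filter fun y => dist b y ≤ 1) ×ˢ (Y \ E)).filter fun p => dist p.1 p.2 = 1).card : ℝ) +
      ∑ x ∈ (Y \ E).filter (fun x => dist b x ≤ 1 ∧ (Y.filter fun q => dist x q = 1).card ≤ 11), ((12 : ℝ) - ((Y.filter fun q => dist x q = 1).card : ℝ))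
    with hD
  set gE : EuclideanSpace ℝ (Fin 3) → ℝ := fun b => (endMultA E v S₁ S₂ b : ℝ) / D b with hgE
  set fX : EuclideanSpace ℝ (Fin 3) → ℝ := fun b => (coreMultA Y E v S₁ S₂ b : ℝ) / pooledDef Y b with hfX
  set fS : EuclideanSpace ℝ (Fin 3) → ℝ := fun b => (seamCoreMultA Y E v S₁ S₂ b : ℝ) / pooledDef Y b with hfS
  -- termwise split of the summand
  have hsplit : ∀ b ∈ A, (endMultA Y v S₁ S₂ b : ℝ) / pooledDef Y b = fX b + fS b := by
    intro b _
    simp only [hfX, hfS, ← add_div]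
    congr 1
    exact_mod_cast (coreMultA_add_seamCoreMultA (Y := Y) (E := E) (v := v) (S₁ := S₁) (S₂ := S₂) b).symm
  rw [sum_congr rfl hsplit, sum_add_distrib]
  -- core part (verbatim)
  have hexact : ∑ b ∈ A, fX b ≤ ∑ b ∈ AE, gE b := by
    have key : ∀ b ∈ A, (0 < coreMultA Y E v S₁ S₂ b → b ∈ AE ∧ fX b ≤ gE b) ∧ (coreMultA Y E v S₁ S₂ b = 0 → fX b = 0) := by
      intro b hb
      obtain ⟨hbY, hb1, hepos⟩ := mem_filter.1 hb
      refine ⟨fun hx => ?_, fun h0 => by simp only [hfX, h0, Nat.cast_zero, zero_div]⟩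
      obtain ⟨q, hq⟩ : ∃ q, q ∈ Y.filter fun q => IsCorePairA Y E v S₁ S₂ b q := by
        by_contra hne
        push Not at hne
        have : coreMultA Y E v S₁ S₂ b = 0 := by
          unfold coreMultA; rw [card_eq_zero]; exact eq_empty_of_forall_notMem hne
        omega
      obtain ⟨-, -, -, G, d, -, -, -, -, hbE, -⟩ := (mem_filter.1 hq).2
      have hle := hexle b
      have hp := hpoolle b
      have hDpos : 0 < D b := hposE b hbE hb1 (lt_of_lt_of_le hx hle)
      have hDle : D b ≤ pooledDef Y b := by simp only [hD]; linarith
      refine ⟨mem_filter.2 ⟨hbE, hb1, lt_of_lt_of_le hx hle⟩, ?_⟩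
      have hleR : (coreMultA Y E v S₁ S₂ b : ℝ) ≤ (endMultA E v S₁ S₂ b : ℝ) := by exact_mod_cast hle
      calc fX b = (coreMultA Y E v S₁ S₂ b : ℝ) / pooledDef Y b := rfl
        _ ≤ (endMultA E v S₁ S₂ b : ℝ) / pooledDef Y b := div_le_div_of_nonneg_right hleR (hDpos.le.trans hDle)
        _ ≤ gE b := div_le_div_of_nonneg_left (Nat.cast_nonneg _) hDpos hDle
    have hgnn : ∀ b ∈ AE, 0 ≤ gE b := fun b hb => div_nonneg (Nat.cast_nonneg _) (hposE b (mem_filter.1 hb).1 (mem_filter.1 hb).2.1 (mem_filter.1 hb).2.2).le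
    calc ∑ b ∈ A, fX b = ∑ b ∈ A.filter (fun b => 0 < coreMultA Y E v S₁ S₂ b), fX b :=
          (sum_filter_of_ne fun b hb hne => Nat.pos_of_ne_zero fun h0 => hne ((key b hb).2 h0)).symm
      _ ≤ ∑ b ∈ A.filter (fun b => 0 < coreMultA Y E v S₁ S₂ b), gE b :=
          sum_le_sum fun b hb => ((key b (mem_filter.1 hb).1).1 (mem_filter.1 hb).2).2
      _ ≤ ∑ b ∈ AE, gE b :=
          sum_le_sum_of_subset_of_nonneg (fun b hb => ((key b (mem_filter.1 hb).1).1 (mem_filter.1 hb).2).1) fun b hb _ => hgnn b hb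
  -- seam part: an identity (seam-loaded balls are loaded; unloaded seam terms vanish)
  have hseam' : ∑ b ∈ A, fS b = ∑ b ∈ AS, fS b := by
    have hASA : AS = A.filter fun b => 0 < seamCoreMultA Y E v S₁ S₂ b := by
      ext b
      simp only [hAS, hA, mem_filter]
      constructor
      · rintro ⟨hbY, hb1, hs⟩
        refine ⟨⟨hbY, hb1, ?_⟩, hs⟩
        have := coreMultA_add_seamCoreMultA (Y := Y) (E := E) (v := v) (S₁ := S₁) (S₂ := S₂) b
        omega
      · rintro ⟨⟨hbY, hb1, -⟩, hs⟩
        exact ⟨hbY, hb1, hs⟩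
    rw [hASA]
    exact (sum_filter_of_ne fun b _ hne => Nat.pos_of_ne_zero fun h0 => hne (by simp only [hfS, h0, Nat.cast_zero, zero_div])).symm
  rw [hseam']
  linarith

end SplitSum

/-! ### The Σ-form seam input and the assembly -/

section AssemblySum

variable (cap : Finset (EuclideanSpace ℝ (Fin 3)) → EuclideanSpace ℝ (Fin 3) → ℕ)

open scoped Classical in
/-- The SEAM SUM of the payer window for the placement `S` and the frame `L`: `Σ_{b ∈ X, |b−z| ≤ 1, seam-loaded} seamCoreMultA(b)/pooledDef X b`, the seam pairs
being the (A)-end pairs with a participant outside the canonical core `coreOf X z S`. -/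
def seamSum (L : EuclideanSpace ℝ (Fin 3) ≃ₗᵢ[ℝ] EuclideanSpace ℝ (Fin 3)) (X : Finset (EuclideanSpace ℝ (Fin 3))) (z : EuclideanSpace ℝ (Fin 3))
    (S : EuclideanSpace ℝ (Fin 3) ≃ₗᵢ[ℝ] EuclideanSpace ℝ (Fin 3)) : ℝ :=
  ∑ b ∈ X.filter (fun b => dist z b ≤ 1 ∧
      0 < seamCoreMultA X (coreOf X z S) WordVersion.v2 (basalSystem L) (basalSystem (((ℝ ∙ EuclideanSpace.single (2 : Fin 3) (1 : ℝ)).reflection).trans L)) b),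
    (seamCoreMultA X (coreOf X z S) WordVersion.v2 (basalSystem L) (basalSystem (((ℝ ∙ EuclideanSpace.single (2 : Fin 3) (1 : ℝ)).reflection).trans L)) b : ℝ) /
      pooledDef X b

open scoped Classical in
/-- **SEAM SUM SMALLNESS (named input; analytic, Σ-form)**: at a residual NON-coherent payer window, a deletion of inessential balls lands on-site or, for SOME
placement `S`, the seam sum of the frame `L` is `≤ σ₀`. -/
def SeamSumSmall (σ₀ : ℝ) (k₀ : ℕ) : Prop :=
  ∀ L : EuclideanSpace ℝ (Fin 3) ≃ₗᵢ[ℝ] EuclideanSpace ℝ (Fin 3),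
  ∀ X : Finset (EuclideanSpace ℝ (Fin 3)), (∀ p ∈ X, ∀ q ∈ X, p ≠ q → 1 ≤ dist p q) →
  ∀ z ∈ X, (X.filter fun q => dist z q = 1).card ≤ 11 → ¬ OnSiteAt coaxialModuleUniverse X z → ¬ MonoModuleAt L X z →
    k₀ < (X.filter fun q => dist z q = 1).card → ¬ JammedOneAt X z → ¬ CoherentAt X z →
    HasDeletionOnSite X z ∨ ∃ S : EuclideanSpace ℝ (Fin 3) ≃ₗᵢ[ℝ] EuclideanSpace ℝ (Fin 3), seamSum L X z S ≤ σ₀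

/-- Monotonicity of the Σ-form seam input. -/
theorem seamSumSmall_mono {σ₀ σ₁ : ℝ} {k₀ k₁ : ℕ} (h : SeamSumSmall σ₀ k₀) (hσ : σ₀ ≤ σ₁) (hk : k₀ ≤ k₁) : SeamSumSmall σ₁ k₁ := by
  intro L X hX z hz hdeg hoff hM hk' hJ hco
  rcases h L X hX z hz hdeg hoff hM (lt_of_le_of_lt hk hk') hJ hco with hdel | ⟨S, hS⟩
  · exact Or.inl hdel
  · exact Or.inr ⟨S, hS.trans hσ⟩

open scoped Classical in
/-- **The per-ball input implies the Σ-form input** with `σ₀ = n₀/p₀`. -/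
theorem seamSumSmall_of_seamSparsity {p₀ : ℝ} {n₀ k₀ : ℕ} (h : SeamSparsity p₀ n₀ k₀) (hp₀ : 0 < p₀) : SeamSumSmall (n₀ / p₀) k₀ := by
  intro L X hX z hz hdeg hoff hM hk hJ hco
  rcases h L X hX z hz hdeg hoff hM hk hJ hco with hdel | ⟨S, hn, hratio⟩
  · exact Or.inl hdel
  refine Or.inr ⟨S, ?_⟩
  unfold seamSum
  set S₁ := basalSystem L
  set S₂ := basalSystem (((ℝ ∙ EuclideanSpace.single (2 : Fin 3) (1 : ℝ)).reflection).trans L)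
  set AS := X.filter (fun b => dist z b ≤ 1 ∧ 0 < seamCoreMultA X (coreOf X z S) WordVersion.v2 S₁ S₂ b) with hAS
  have hterm : ∀ b ∈ AS, (seamCoreMultA X (coreOf X z S) WordVersion.v2 S₁ S₂ b : ℝ) / pooledDef X b ≤ 1 / p₀ := by
    intro b hb
    obtain ⟨hbX, hzb, hs⟩ := mem_filter.1 hb
    have hle := hratio b hbX hzb hs
    have hspos : (0 : ℝ) < (seamCoreMultA X (coreOf X z S) WordVersion.v2 S₁ S₂ b : ℝ) := by exact_mod_cast hs
    have hP : 0 < pooledDef X b := lt_of_lt_of_le (mul_pos hp₀ hspos) hle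
    rw [div_le_div_iff₀ hP hp₀, one_mul, mul_comm]
    exact hle
  calc ∑ b ∈ AS, (seamCoreMultA X (coreOf X z S) WordVersion.v2 S₁ S₂ b : ℝ) / pooledDef X b ≤ ∑ b ∈ AS, 1 / p₀ := sum_le_sum hterm
    _ = (AS.card : ℝ) / p₀ := by rw [sum_const, nsmul_eq_mul, mul_one_div]
    _ ≤ (n₀ : ℝ) / p₀ := div_le_div_of_nonneg_right (by exact_mod_cast hn) hp₀.le

open scoped Classical in
/-- **THE ASSEMBLY, Σ-form on the seam side**: erosion-lowered coherent certificate + junk cap bound + seam sum smallness ⇒ the Σ-form incoherent stub at the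
line `s ≥ s₁ + σ₀`. -/
theorem incoherentSeamSmall_of_assembly_sum {s s₁ σ₀ : ℝ} {k₀ : ℕ} (hcert : CoherentCoreCap cap s₁) (hcap : JunkCapBound cap)
    (hsp : SeamSumSmall σ₀ k₀) (hs : s₁ + σ₀ ≤ s) : IncoherentSeamSmall s k₀ := by
  intro L X hX z hz hdeg hoff hM hk hJ hco
  rcases hsp L X hX z hz hdeg hoff hM hk hJ hco with hdel | ⟨S, hσ⟩
  · exact Or.inl hdel
  right
  set S₁ := basalSystem L with hS₁
  set S₂ := basalSystem (((ℝ ∙ EuclideanSpace.single (2 : Fin 3) (1 : ℝ)).reflection).trans L) with hS₂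
  set D := coreOf X z S with hD
  have hDX : D ⊆ X := coreOf_subset X z S
  have hDsep : ∀ p ∈ D, ∀ q ∈ D, p ≠ q → 1 ≤ dist p q := fun p hp q hq => hX p (hDX hp) q (hDX hq)
  have hzD : z ∈ D := mem_coreOf_self hz S
  have hdegD : (D.filter fun q => dist z q = 1).card ≤ 11 :=
    (card_le_card (fun q hq => mem_filter.2 ⟨hDX (mem_filter.1 hq).1, (mem_filter.1 hq).2⟩)).trans hdeg
  obtain ⟨hpos, hsum⟩ := hcert L D hDsep z hzD hdegD (coherentAt_coreOf S)
  have h₁ : S₁.RT ⊆ fccSlots := filter_subset _ _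
  have h₂ : S₂.RT ⊆ fccSlots := filter_subset _ _
  have hheal : ∀ b, dist z b ≤ 1 →
      ((((D.filter fun y => dist b y ≤ 1) ×ˢ (X \ D)).filter fun p => dist p.1 p.2 = 1).card : ℝ) ≤
        ∑ y ∈ D.filter (fun y => dist b y ≤ 1), (cap D y : ℝ) := fun b hzb => heal_le_capSum cap hX hcap hz S hzb
  have hdefnn : ∀ b, 0 ≤ ∑ x ∈ (X \ D).filter (fun x => dist b x ≤ 1 ∧ (X.filter fun q => dist x q = 1).card ≤ 11),
      ((12 : ℝ) - ((X.filter fun q => dist x q = 1).card : ℝ)) := by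
    intro b
    refine sum_nonneg fun x hx => ?_
    have h11 := (mem_filter.1 hx).2.2
    have : ((X.filter fun q => dist x q = 1).card : ℝ) ≤ 11 := by exact_mod_cast h11
    linarith
  have hcmp : ∀ b, dist z b ≤ 1 → capPool cap D b ≤
      pooledDef D b - ((((D.filter fun y => dist b y ≤ 1) ×ˢ (X \ D)).filter fun p => dist p.1 p.2 = 1).card : ℝ) +
        ∑ x ∈ (X \ D).filter (fun x => dist b x ≤ 1 ∧ (X.filter fun q => dist x q = 1).card ≤ 11),
          ((12 : ℝ) - ((X.filter fun q => dist x q = 1).card : ℝ)) := by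
    intro b hzb
    have h1 := hheal b hzb
    have h2 := hdefnn b
    simp only [capPool]
    linarith
  have hposE : ∀ b ∈ D, dist z b ≤ 1 → 0 < endMultA D WordVersion.v2 S₁ S₂ b →
      0 < pooledDef D b - ((((D.filter fun y => dist b y ≤ 1) ×ˢ (X \ D)).filter fun p => dist p.1 p.2 = 1).card : ℝ) +
        ∑ x ∈ (X \ D).filter (fun x => dist b x ≤ 1 ∧ (X.filter fun q => dist x q = 1).card ≤ 11),
          ((12 : ℝ) - ((X.filter fun q => dist x q = 1).card : ℝ)) :=
    fun b hb hzb he => lt_of_lt_of_le (hpos b hb hzb he) (hcmp b hzb)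
  have hsplit := localSummandA_le_core_add_seamSum (Y := X) (E := D) (v := WordVersion.v2) (S₁ := S₁) (S₂ := S₂) hX hDX h₁ h₂ z hposE
  have hcore : (∑ b ∈ D.filter (fun b => dist z b ≤ 1 ∧ 0 < endMultA D WordVersion.v2 S₁ S₂ b),
      (endMultA D WordVersion.v2 S₁ S₂ b : ℝ) /
        (pooledDef D b - ((((D.filter fun y => dist b y ≤ 1) ×ˢ (X \ D)).filter fun p => dist p.1 p.2 = 1).card : ℝ) +
          ∑ x ∈ (X \ D).filter (fun x => dist b x ≤ 1 ∧ (X.filter fun q => dist x q = 1).card ≤ 11),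
            ((12 : ℝ) - ((X.filter fun q => dist x q = 1).card : ℝ)))) ≤ capSummand cap WordVersion.v2 S₁ S₂ D z := by
    unfold capSummand
    refine sum_le_sum fun b hb => ?_
    obtain ⟨hbD, hzb, he⟩ := mem_filter.1 hb
    exact div_le_div_of_nonneg_left (Nat.cast_nonneg _) (hpos b hbD hzb he) (hcmp b hzb)
  have hseam : (∑ b ∈ X.filter (fun b => dist z b ≤ 1 ∧ 0 < seamCoreMultA X D WordVersion.v2 S₁ S₂ b),
      (seamCoreMultA X D WordVersion.v2 S₁ S₂ b : ℝ) / pooledDef X b) ≤ σ₀ := hσ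
  linarith

/-- **The Σ-form assembly with the junk input discharged** (`…SeamJunkCapTable.junkCapBound_capTable₀`): any cap function dominating `capTable₀`. -/
theorem incoherentSeamSmall_of_cert_of_seamSum {cap : Finset (EuclideanSpace ℝ (Fin 3)) → EuclideanSpace ℝ (Fin 3) → ℕ}
    (hle : ∀ D y, capTable₀ D y ≤ cap D y) {s s₁ σ₀ : ℝ} {k₀ : ℕ} (hcert : CoherentCoreCap cap s₁) (hsp : SeamSumSmall σ₀ k₀) (hs : s₁ + σ₀ ≤ s) :
    IncoherentSeamSmall s k₀ :=
  incoherentSeamSmall_of_assembly_sum cap hcert (junkCapBound_mono junkCapBound_capTable₀ hle) hsp hs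

end AssemblySum

end TailResidue

end Summit.Ventures.Crystal3D.Theorems

end
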